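import Summits.NavierStokesRegularity.OSWSelfSimilar.SheetNSLineTorusCascadeScaling
import Summits.NavierStokesRegularity.OSWSelfSimilar.SheetNSLineTorusCascadeTailStatic
import Summits.NavierStokesRegularity.OSWSelfSimilar.SheetNSLineTorusCascadeLink
import HarnessLib

/-!
# Viscous CLM on the torus (`a = 0`, `σ = 2`): the CERTIFIED-BASE PLUG — ONE static lower-bound table for the universal family `E`
# on ONE window ⇒ blow-up of EVERY sine cascade with `λ₁ c ≥ ν` at `t = (α + L/k₀)/ν`, and NO CLASSICAL SOLUTION of the MODEL PDE
# from `−c sin x` survives to that time (composition with the classical-solution link)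

HONEST FRAMING (cell ns-blowup GROUP B «PROFILE SEARCH», zone Z3, row Z3-U addendum A-F2 of `HOME/profile/z3/CENSUS-Z3.md`;
human rulings D-0035/D-0074; Z3-TWIN lineage): **1-D MODEL (viscous Constantin–Lax–Majda equation `ω_t = ω Hω + ν ω_xx` on `𝕋`,
`H = hilbertTransformCircle`); kernel-checked composition of ODE comparison lemmas with the classical-solution ⇒ cascade link;
not Euler, not Navier–Stokes; «violates: none — MODEL». No number is certified by THIS file: the lower-bound table is a NAMED
HYPOTHESIS (`base`), supplied outside the kernel by a directed-rounding script (see READING).**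

OBJECTS. `IsSineCascade ν c e` (`SheetNSLineTorusCascade`); the universal family `E := cascadeSolution 1 (sineDatum 1)` and the
dictionary `e_k(t) = ν (c/ν)^k E_k(νt)` (`SheetNSLineTorusCascadeScaling`); the static deficiency-tolerant tail induction
`unbounded_of_base_static` (`SheetNSLineTorusCascadeTailStatic`, p513808); the classical-solution class `IsClassicalSolution ν T ω ωt ωx ωxx`
and the transfer theorem `horizon_lt_of_cascade_unbounded` (`SheetNSLineTorusCascadeLink`, eng-3 g9, p512652).

THEOREMS (all hypotheses on the table are stated ONCE, at `ν = 1`, for the universal family `E` on the window `[α, T]`):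
* `unbounded_one_of_universal_static_base` — at `ν = 1`: every sine cascade with datum `q`, `λ₁ q ≥ 1`, is unbounded in `k` at every
  `s ∈ [α + L/k₀, T]` (homogeneity `f_k = q^k E_k` turns the `E`-table into the `base` of `unbounded_of_base_static` with `λ = λ₁ q ≥ 1`);
* `unbounded_of_universal_static_base` — every `(ν, c)` with `0 < ν ≤ λ₁ c`: EVERY `IsSineCascade ν c e` is unbounded in `k` at every
  `t ∈ [(α + L/k₀)/ν, T/ν]` (time/viscosity scaling `e_k(t) = ν f_k(νt)`); this is the `∀ e` form the link theorem consumes;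
* `horizon_lt_of_universal_static_base` — **PDE level**: every classical `2π`-periodic solution of the MODEL PDE on `[0, T′]` with
  `ω(0,·) = −c sin`, `0 < ν ≤ λ₁ c`, has `T′ < (α + L/k₀)/ν`;
* `datum_lt_of_classicalSolution` — contrapositive (census form): a classical solution from `−c sin x` that exists on `[0, (α + L/k₀)/ν]`
  has `λ₁ c < ν`.
READING (what is OUTSIDE the kernel). The Z3-TWIN certificate `HOME/profile/z3twin/engine/cascade/` (cert_upper.py d824daea49b83273 +
plug_static.py bf80c8d4d92da732; output `runs/Z3-cascade-CERT-C_j272195/outputs/plug_static_K6000_inseat.json`) supplies, in 100-digit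
decimal arithmetic with directed rounding, an instance of the hypotheses: `k₀ = 6000`, `L = 6`, `α = 0.414706058`, `T = 0.415706058`
(so `α + L/k₀ = T`), `A = 12.08168…`, `λ₁ = 0.0505645850…`, a deficiency table `ζ_j` (`j ≤ 6000`, `Z ≤ 10043.07`, `1 + 12Z ≤ 6001²`,
`12 ≤ A(1 − e^{−6})(1 − (1 + 12Z)/6001²)`), and `base`: `A j λ₁^j (1 − ζ_j) ≤ l_j ≤ E_j(s)` on `[α, T]` from exact head infima and the
quasi-static tail recursion. WITH THAT DATUM the theorems read: **for every `ν > 0` and every `c ≥ ν/λ₁ = 19.7766876·ν`, no classical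
solution of `ω_t = ω Hω + ν ω_xx` on `𝕋` from `ω₀ = −c sin x` exists on `[0, 0.415706058/ν]`** — the upper side of the bracket of record
`19.7755478 ≤ c*/ν ≤ 19.7766876` as «SCRIPT datum + ONE kernel theorem at the PDE level». The fully-kernel (datum-free) sentence remains
`horizon_lt_log_two_div` (`c ≥ 48ν`, horizon `< log 2/ν`). What stays PRINT: local well-posedness of the MODEL PDE in the classical class
(so «no classical solution on `[0, τ]`» is how «blow-up at or before `τ`» reads; ALSS 2024 §3). bears_on: LADDER-NS N5 / zone Z3 (row Z3-U)
→ N1 linear core. WHAT THIS IS NOT: not NS; no definitions; no number certified here.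
-/

namespace Summit.NavierStokesRegularity.OSWSelfSimilar
namespace SheetNSLineTorusCascade

open Finset Real Set

variable {ν c : ℝ} {e : ℕ → ℝ → ℝ}

/-- **CERTIFIED-BASE BLOW-UP AT `ν = 1`.** Let `A > 0`, `λ₁ > 0`, `0 ≤ α`, `0 < L`, `1 ≤ k₀`, deficiencies `0 ≤ ζ_j ≤ 1` vanishing for
`j > k₀` with `Σ_{j≤n} j ζ_j ≤ Z` (all `n`), `1 + 12Z ≤ (k₀+1)²`, `12 ≤ A(1 − e^{−L})(1 − (1+12Z)/(k₀+1)²)`, and suppose the universal family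
`E = cascadeSolution 1 (sineDatum 1)` satisfies `A j λ₁^j (1 − ζ_j) ≤ E_j(s)` for `j ≤ k₀`, `s ∈ [α, T]`. Then every sine cascade `f` with
`ν = 1` and datum `q` with `λ₁ q ≥ 1` has `k ↦ f_k(s)` unbounded above at every `s ∈ [α + L/k₀, T]`. [new here — MODEL] -/
theorem unbounded_one_of_universal_static_base {A lam₁ α T L Z : ℝ} (hA : 0 < A) (hlam₁ : 0 < lam₁)
    (hα : 0 ≤ α) (hL : 0 < L) {k₀ : ℕ} (hk₀ : 1 ≤ k₀) (ζ : ℕ → ℝ) (hζ0 : ∀ j, 0 ≤ ζ j) (hζ1 : ∀ j, ζ j ≤ 1)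
    (hζsupp : ∀ j, k₀ < j → ζ j = 0) (hZ : ∀ n, ∑ j ∈ range (n + 1), (j : ℝ) * ζ j ≤ Z)
    (hZk : 1 + 12 * Z ≤ ((k₀ : ℝ) + 1) ^ 2)
    (hAL : 12 ≤ A * (1 - exp (-L)) * (1 - (1 + 12 * Z) / ((k₀ : ℝ) + 1) ^ 2))
    (base : ∀ j, j ≤ k₀ → ∀ s ∈ Icc α T,
      A * (j : ℝ) * lam₁ ^ j * (1 - ζ j) ≤ cascadeSolution 1 (sineDatum 1) j s)
    {q : ℝ} (hq : 1 ≤ lam₁ * q) {f : ℕ → ℝ → ℝ} (hf : IsSineCascade 1 q f)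
    {s : ℝ} (hs : s ∈ Icc (α + L / (k₀ : ℝ)) T) : ∀ M : ℝ, ∃ k : ℕ, M < f k s := by
  have hq0 : 0 ≤ q := by
    by_contra hneg
    have : lam₁ * q ≤ 0 := mul_nonpos_of_nonneg_of_nonpos hlam₁.le (le_of_lt (not_le.mp hneg))
    linarith
  -- `f = q^k E` on `[0, ∞)` (amplitude homogeneity + uniqueness)
  have hfE : ∀ k : ℕ, ∀ t : ℝ, 0 ≤ t → f k t = q ^ k * cascadeSolution 1 (sineDatum 1) k t :=
    (isSineCascade_cascadeSolution 1 1).eq_smul_pow_of_datum (lam := q) (e' := f) (by simpa using hf)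
  -- the `E`-table becomes the base of the static tail induction for `f`, with rate `λ = λ₁ q ≥ 1`
  have base' : ∀ j, j ≤ k₀ → ∀ s ∈ Icc α T, A * (j : ℝ) * (lam₁ * q) ^ j * (1 - ζ j) ≤ f j s := by
    intro j hj s' hs'
    rw [hfE j s' (le_trans hα hs'.1), mul_pow]
    have hb := base j hj s' hs'
    have hqj : 0 ≤ q ^ j := pow_nonneg hq0 j
    calc A * (j : ℝ) * (lam₁ ^ j * q ^ j) * (1 - ζ j) = q ^ j * (A * (j : ℝ) * lam₁ ^ j * (1 - ζ j)) := by ring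
      _ ≤ q ^ j * cascadeSolution 1 (sineDatum 1) j s' := mul_le_mul_of_nonneg_left hb hqj
  have hAL' : 12 * (1 : ℝ) ≤ A * (1 - exp (-L)) * (1 - (1 + 12 * Z) / ((k₀ : ℝ) + 1) ^ 2) := by rw [mul_one]; exact hAL
  have hs' : s ∈ Icc (α + L / (1 * (k₀ : ℝ))) T := by rw [one_mul]; exact hs
  exact unbounded_of_base_static hf one_pos hq0 hA (by positivity) hα hL hk₀ ζ hζ0 hζ1 hζsupp hZ hZk hAL' base' hq hs'

/-- **CERTIFIED-BASE BLOW-UP FOR EVERY `(ν, c)` WITH `λ₁ c ≥ ν`** (the `∀ e` form consumed by the classical-solution link). Under the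
hypotheses of `unbounded_one_of_universal_static_base` on the universal family `E`: for every `ν > 0`, every `c` with `ν ≤ λ₁ c`, and
EVERY sine cascade `e` with parameters `(ν, c)`, the sequence `k ↦ e_k(t)` is unbounded above at every `t ∈ [(α + L/k₀)/ν, T/ν]`
(`e_k(t) = ν (c/ν)^k E_k(νt)`). [new here — MODEL] -/
theorem unbounded_of_universal_static_base {A lam₁ α T L Z : ℝ} (hA : 0 < A) (hlam₁ : 0 < lam₁)
    (hα : 0 ≤ α) (hL : 0 < L) {k₀ : ℕ} (hk₀ : 1 ≤ k₀) (ζ : ℕ → ℝ) (hζ0 : ∀ j, 0 ≤ ζ j) (hζ1 : ∀ j, ζ j ≤ 1)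
    (hζsupp : ∀ j, k₀ < j → ζ j = 0) (hZ : ∀ n, ∑ j ∈ range (n + 1), (j : ℝ) * ζ j ≤ Z)
    (hZk : 1 + 12 * Z ≤ ((k₀ : ℝ) + 1) ^ 2)
    (hAL : 12 ≤ A * (1 - exp (-L)) * (1 - (1 + 12 * Z) / ((k₀ : ℝ) + 1) ^ 2))
    (base : ∀ j, j ≤ k₀ → ∀ s ∈ Icc α T,
      A * (j : ℝ) * lam₁ ^ j * (1 - ζ j) ≤ cascadeSolution 1 (sineDatum 1) j s)
    (hν : 0 < ν) (hc : ν ≤ lam₁ * c) (he : IsSineCascade ν c e)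
    {t : ℝ} (ht : t ∈ Icc ((α + L / (k₀ : ℝ)) / ν) (T / ν)) : ∀ M : ℝ, ∃ k : ℕ, M < e k t := by
  have hk₀pos : (0 : ℝ) < k₀ := by exact_mod_cast hk₀
  -- the `ν = 1` cascade with datum `q = c/ν`
  have hq : 1 ≤ lam₁ * (c / ν) := by
    rw [← mul_div_assoc, le_div_iff₀ hν, one_mul]
    exact hc
  have hf : IsSineCascade 1 (c / ν) (fun k s => (c / ν) ^ k * cascadeSolution 1 (sineDatum 1) k s) := by
    simpa using (isSineCascade_cascadeSolution 1 1).smul_pow (c / ν)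
  have ht0 : 0 ≤ t := le_trans (div_nonneg (by positivity) hν.le) ht.1
  have hs : ν * t ∈ Icc (α + L / (k₀ : ℝ)) T := by
    constructor
    · have h1 := ht.1
      rw [div_le_iff₀ hν] at h1
      linarith
    · have h2 := ht.2
      rw [le_div_iff₀ hν] at h2
      linarith
  have key := unbounded_one_of_universal_static_base hA hlam₁ hα hL hk₀ ζ hζ0 hζ1 hζsupp hZ hZk hAL base hq hf hs
  intro M
  obtain ⟨k, hk⟩ := key (M / ν)
  refine ⟨k, ?_⟩
  rw [he.eq_universal hν k t ht0]
  rw [div_lt_iff₀ hν] at hk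
  have : M < ν * ((c / ν) ^ k * cascadeSolution 1 (sineDatum 1) k (ν * t)) := by linarith
  simpa [mul_assoc] using this

/-- **PDE LEVEL: NO CLASSICAL SOLUTION FROM `−c sin x`, `λ₁ c ≥ ν`, SURVIVES TO `t = (α + L/k₀)/ν`.** Under the hypotheses of
`unbounded_one_of_universal_static_base` on the universal family `E` and `α + L/k₀ ≤ T`: for every `ν > 0` and every `c` with
`ν ≤ λ₁ c`, every classical `2π`-periodic solution of `ω_t = ω·Hω + ν ω_xx` on `[0, T′]` with `ω(0,·) = −c sin` has
`T′ < (α + L/k₀)/ν` (`horizon_lt_of_cascade_unbounded` fed with `unbounded_of_universal_static_base`). With the Z3-TWIN script datum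
(`k₀ = 6000`, `L = 6`, `α + L/k₀ = T = 0.415706058`, `1/λ₁ = 19.7766876`): no classical solution from `−c sin x`, `c ≥ 19.7766876ν`,
exists on `[0, 0.4157061/ν]`. [new here — MODEL] -/
theorem horizon_lt_of_universal_static_base {T' : ℝ} {ω ωt ωx ωxx : ℝ → ℝ → ℝ}
    (h : IsClassicalSolution ν T' ω ωt ωx ωxx) (hω0 : ∀ x, ω 0 x = -c * Real.sin x)
    {A lam₁ α T L Z : ℝ} (hA : 0 < A) (hlam₁ : 0 < lam₁)
    (hα : 0 ≤ α) (hL : 0 < L) {k₀ : ℕ} (hk₀ : 1 ≤ k₀) (ζ : ℕ → ℝ) (hζ0 : ∀ j, 0 ≤ ζ j) (hζ1 : ∀ j, ζ j ≤ 1)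
    (hζsupp : ∀ j, k₀ < j → ζ j = 0) (hZ : ∀ n, ∑ j ∈ range (n + 1), (j : ℝ) * ζ j ≤ Z)
    (hZk : 1 + 12 * Z ≤ ((k₀ : ℝ) + 1) ^ 2)
    (hAL : 12 ≤ A * (1 - exp (-L)) * (1 - (1 + 12 * Z) / ((k₀ : ℝ) + 1) ^ 2))
    (base : ∀ j, j ≤ k₀ → ∀ s ∈ Icc α T,
      A * (j : ℝ) * lam₁ ^ j * (1 - ζ j) ≤ cascadeSolution 1 (sineDatum 1) j s)
    (hT : α + L / (k₀ : ℝ) ≤ T) (hν : 0 < ν) (hc : ν ≤ lam₁ * c) :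
    T' < (α + L / (k₀ : ℝ)) / ν := by
  have hk₀pos : (0 : ℝ) < k₀ := by exact_mod_cast hk₀
  have hτ : 0 < (α + L / (k₀ : ℝ)) / ν := div_pos (by positivity) hν
  exact horizon_lt_of_cascade_unbounded h hω0 hτ fun e he =>
    unbounded_of_universal_static_base hA hlam₁ hα hL hk₀ ζ hζ0 hζ1 hζsupp hZ hZk hAL base hν hc he
      ⟨le_rfl, div_le_div_of_nonneg_right hT hν.le⟩

/-- **Contrapositive (census form).** Under the same hypotheses on the universal family: if a classical `2π`-periodic solution of the
MODEL PDE from `ω(0,·) = −c sin` exists on `[0, T′]` with `(α + L/k₀)/ν ≤ T′` (`ν > 0`), then `λ₁ c < ν` — with the Z3-TWIN script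
datum: `c < 19.7766876·ν`. [new here — MODEL] -/
theorem datum_lt_of_classicalSolution {T' : ℝ} {ω ωt ωx ωxx : ℝ → ℝ → ℝ}
    (h : IsClassicalSolution ν T' ω ωt ωx ωxx) (hω0 : ∀ x, ω 0 x = -c * Real.sin x)
    {A lam₁ α T L Z : ℝ} (hA : 0 < A) (hlam₁ : 0 < lam₁)
    (hα : 0 ≤ α) (hL : 0 < L) {k₀ : ℕ} (hk₀ : 1 ≤ k₀) (ζ : ℕ → ℝ) (hζ0 : ∀ j, 0 ≤ ζ j) (hζ1 : ∀ j, ζ j ≤ 1)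
    (hζsupp : ∀ j, k₀ < j → ζ j = 0) (hZ : ∀ n, ∑ j ∈ range (n + 1), (j : ℝ) * ζ j ≤ Z)
    (hZk : 1 + 12 * Z ≤ ((k₀ : ℝ) + 1) ^ 2)
    (hAL : 12 ≤ A * (1 - exp (-L)) * (1 - (1 + 12 * Z) / ((k₀ : ℝ) + 1) ^ 2))
    (base : ∀ j, j ≤ k₀ → ∀ s ∈ Icc α T,
      A * (j : ℝ) * lam₁ ^ j * (1 - ζ j) ≤ cascadeSolution 1 (sineDatum 1) j s)
    (hT : α + L / (k₀ : ℝ) ≤ T) (hν : 0 < ν) (hT' : (α + L / (k₀ : ℝ)) / ν ≤ T') : lam₁ * c < ν := by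
  by_contra hcon
  have hlt := horizon_lt_of_universal_static_base h hω0 hA hlam₁ hα hL hk₀ ζ hζ0 hζ1 hζsupp hZ hZk hAL base hT hν (not_lt.mp hcon)
  exact absurd hT' (not_le.mpr hlt)

end SheetNSLineTorusCascade
end Summit.NavierStokesRegularity.OSWSelfSimilar
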